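import Literature.Topology.FourManifolds.PeriodicShearCutoffs
import Mathlib.Analysis.Calculus.Deriv.MeanValue
import Literature.Topology.FourManifolds.InverseFunctionTheorem
import HarnessLib

/-!
# Height-preserving periodic shears of the plane carrying vertical lines onto prescribed graphs

Topic `Literature/Topology/FourManifolds`; sequel of `PeriodicShearCutoffs.lean`.  **Everything
is proved; the definitions are explicit formulas; no named facts.**

Given finitely many real numbers `θᵢ` pairwise distinct modulo `ℤ`, smooth functions
`φᵢ : ℝ → ℝ` with `φᵢ 0 = 0`, and `δ₀ > 0`:

* `PeriodicShear.shearFun δ η θs φ (θ, h) = κ(h) Σᵢ λᵢ(θ) φᵢ(h)` (the displacement, with the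
  periodic bumps `λᵢ = shearBump η θᵢ` and the height cutoff
  `κ = shearHeightCut δ`) and
  `PeriodicShear.shear δ η θs φ (θ, h) = (θ + shearFun (θ, h), h)`;
* `PeriodicShear.exists_shear` — **for suitable `η > 0` and some `0 < δ < δ₀` the shear is a
  diffeomorphism `Σ` of `ℝ²` preserving the height, moving points by at most `1/2`,
  commuting with `(θ, h) ↦ (θ + 1, h)`,
  equal to the identity at heights `|h| ≥ δ₀`, and with `Σ (θᵢ, h) = (θᵢ + φᵢ h, h)` for
  `|h| ≤ δ`**: the vertical segment over `θᵢ` goes onto the graph of `φᵢ`.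

Proof: for `δ` small, `|∂ψ/∂θ| ≤ 1/2` and `|ψ| ≤ 1/2` (`exists_delta_small`: the `φᵢ` are
small near `0` and the `λᵢ'` are bounded), so every slice `θ ↦ θ + ψ(θ, h)` is a strictly
increasing surjection (`Σ` is bijective) and `DΣ` is invertible everywhere (inverse function
theorem on manifolds, `isLocalDiffeomorphAt_of_mfderiv`); a bijective local diffeomorphism is a
diffeomorphism (`IsLocalDiffeomorph.diffeomorphOfBijective`).

## Use

In tubular coordinates `(θ, h) ∈ (ℝ/ℤ) × ℝ` around an embedded circle `m` of a surface (lifted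
to `ℝ × ℝ`), a curve crossing `m` transversally at the points of parameters `θᵢ` is, near each
crossing, a graph `θ = θᵢ + φᵢ(h)` (implicit function theorem).  Precomposing the tube with `Σ`
gives new tubular coordinates with the SAME zero section and the SAME height function — hence
the same parallel circles `{h = const}` — in which the curve is vertical (a union of fibres)
near `m`: the normal form in which the smooth curve `α ∪ β₁` of a wave move is assembled from
straight pieces and the corner arcs of `SmoothCornerArc.lean` (Hensel (2020), §5; the
meridian-disc half of Griffiths' theorem, `HandlebodyKernelExtensionTorelli.lean`).  The
periodicity lets `Σ` descend to the annulus `(ℝ/ℤ) × ℝ`.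

## References

* M. W. Hirsch, *Differential Topology*, GTM 33 (1976), Ch. 4 §5 (tubular neighbourhoods and
  their reparametrisations). [HirschDT1976]
* S. Hensel, *A primer on handlebody groups* (2020), §5. [Hensel2020HandlebodyPrimer]
-/

open Set Function Filter Metric Real
open scoped Topology ContDiff Manifold Real

noncomputable section

namespace Literature.Topology.FourManifolds

namespace PeriodicShear

/-! ### §4 The shear -/

variable {ι : Type*} [Fintype ι]

/-- The shear displacement `ψ(θ, h) = κ(h) Σᵢ λᵢ(θ) φᵢ(h)`. [folklore] -/
def shearFun (δ η : ℝ) (θs : ι → ℝ) (φ : ι → ℝ → ℝ) (p : ℝ × ℝ) : ℝ :=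
  shearHeightCut δ p.2 * ∑ i, shearBump η (θs i) p.1 * φ i p.2

/-- The shear `Σ(θ, h) = (θ + ψ(θ, h), h)`. [folklore] -/
def shear (δ η : ℝ) (θs : ι → ℝ) (φ : ι → ℝ → ℝ) (p : ℝ × ℝ) : ℝ × ℝ :=
  (p.1 + shearFun δ η θs φ p, p.2)

variable {δ η : ℝ} {θs : ι → ℝ} {φ : ι → ℝ → ℝ}

/-- The displacement is smooth when the `φᵢ` are. [folklore] -/
theorem contDiff_shearFun (hφ : ∀ i, ContDiff ℝ ∞ (φ i)) :
    ContDiff ℝ ∞ (shearFun δ η θs φ) := by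
  unfold shearFun
  refine ((contDiff_heightCut δ).comp contDiff_snd).mul (ContDiff.sum fun i _ => ?_)
  exact ((contDiff_bump η (θs i)).comp contDiff_fst).mul ((hφ i).comp contDiff_snd)

/-- The shear is smooth when the `φᵢ` are. [folklore] -/
theorem contDiff_shear (hφ : ∀ i, ContDiff ℝ ∞ (φ i)) : ContDiff ℝ ∞ (shear δ η θs φ) :=
  (contDiff_fst.add (contDiff_shearFun hφ)).prodMk contDiff_snd

/-- The shear preserves the height. [folklore] -/
@[simp] theorem shear_snd (p : ℝ × ℝ) : (shear δ η θs φ p).2 = p.2 := rfl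

/-- The first coordinate of the shear. [folklore] -/
@[simp] theorem shear_fst (p : ℝ × ℝ) : (shear δ η θs φ p).1 = p.1 + shearFun δ η θs φ p := rfl

/-- The displacement is `1`-periodic in `θ`. [folklore] -/
theorem shearFun_add_one (p : ℝ × ℝ) :
    shearFun δ η θs φ (p.1 + 1, p.2) = shearFun δ η θs φ p := by
  simp only [shearFun, bump_add_one]

/-- The shear commutes with the unit translation in `θ`. [folklore] -/
theorem shear_add_one (p : ℝ × ℝ) :
    shear δ η θs φ (p.1 + 1, p.2) = ((shear δ η θs φ p).1 + 1, p.2) := by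
  rw [shear, shear_fst, shearFun_add_one]
  ring_nf

/-- The displacement vanishes at heights `|h| ≥ 2δ`. [folklore] -/
theorem shearFun_eq_zero_of_le_abs (hδ : 0 < δ) {p : ℝ × ℝ} (hp : 2 * δ ≤ |p.2|) :
    shearFun δ η θs φ p = 0 := by
  rw [shearFun, heightCut_of_le_abs hδ hp, zero_mul]

/-- **The shear carries the vertical line `θ = θᵢ` onto the graph `θ = θᵢ + φᵢ(h)` at heights
`|h| ≤ δ`**, provided the bumps of the other points vanish at `θᵢ`. [folklore] -/
theorem shear_apply_centre (hδ : 0 < δ) (hη : 0 < η)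
    (hsep : ∀ i j, i ≠ j → 2 * η ≤ 1 - cos (2 * π * (θs i - θs j))) (i : ι) {h : ℝ}
    (hh : |h| ≤ δ) : shear δ η θs φ (θs i, h) = (θs i + φ i h, h) := by
  rw [shear, Prod.mk.injEq]
  refine ⟨?_, rfl⟩
  simp only [shearFun, heightCut_of_abs_le hδ hh, one_mul]
  rw [Finset.sum_eq_single i]
  · rw [bump_self, one_mul]
  · intro j _ hji
    rw [bump_eq_zero hη (hsep i j (Ne.symm hji)), zero_mul]
  · intro hi; exact absurd (Finset.mem_univ i) hi

/-! ### §5 The `θ`-derivative of the displacement and its smallness -/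

/-- The `θ`-slice of the displacement has derivative `κ(h) Σᵢ λᵢ'(θ) φᵢ(h)`. [folklore] -/
theorem hasDerivAt_shearFun_slice (θ h : ℝ) :
    HasDerivAt (fun t => shearFun δ η θs φ (t, h))
      (shearHeightCut δ h * ∑ i, deriv (shearBump η (θs i)) θ * φ i h) θ := by
  unfold shearFun
  simp only
  refine HasDerivAt.const_mul _ (HasDerivAt.fun_sum fun i _ => ?_)
  exact (((contDiff_bump η (θs i) (n := 1)).differentiable (by simp) θ).hasDerivAt).mul_const _

/-- The partial derivative `∂ψ/∂θ` read off the Fréchet derivative. [folklore] -/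
theorem fderiv_shearFun_apply_one_zero (hφ : ∀ i, ContDiff ℝ ∞ (φ i)) (p : ℝ × ℝ) :
    fderiv ℝ (shearFun δ η θs φ) p (1, 0) =
      shearHeightCut δ p.2 * ∑ i, deriv (shearBump η (θs i)) p.1 * φ i p.2 := by
  have hd : HasFDerivAt (shearFun δ η θs φ) (fderiv ℝ (shearFun δ η θs φ) p) p :=
    (((contDiff_shearFun hφ).differentiable (by simp)) p).hasFDerivAt
  have hline : HasDerivAt (fun t : ℝ => ((t, p.2) : ℝ × ℝ)) ((1 : ℝ), (0 : ℝ)) p.1 :=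
    (hasDerivAt_id p.1).prodMk (hasDerivAt_const p.1 p.2)
  have hcomp : HasDerivAt (fun t => shearFun δ η θs φ (t, p.2))
      (fderiv ℝ (shearFun δ η θs φ) p (1, 0)) p.1 := by
    have := hd.comp_hasDerivAt p.1 hline
    exact this
  exact hcomp.unique (hasDerivAt_shearFun_slice p.1 p.2)

/-- **Smallness data.**  Given `δ₀ > 0`, `η > 0` and the smooth `φᵢ` with `φᵢ 0 = 0`, there is
`δ ∈ (0, δ₀/2]` such that `|∂ψ/∂θ| ≤ 1/2` and `|ψ| ≤ 1/2` everywhere (choose `δ` so small that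
`|φᵢ h| (1 + Σ Cᵢ) (card ι + 1) ≤ 1/2` for `|h| < 2δ`, `Cᵢ` bounding `λᵢ'`). [folklore] -/
theorem exists_delta_small (hη : 0 < η) (hφ : ∀ i, ContDiff ℝ ∞ (φ i)) (hφ0 : ∀ i, φ i 0 = 0)
    {δ₀ : ℝ} (hδ₀ : 0 < δ₀) :
    ∃ δ : ℝ, 0 < δ ∧ 2 * δ ≤ δ₀ ∧
      (∀ p : ℝ × ℝ,
        |shearHeightCut δ p.2 * ∑ i, deriv (shearBump η (θs i)) p.1 * φ i p.2| ≤ 1 / 2) ∧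
      (∀ p : ℝ × ℝ, |shearFun δ η θs φ p| ≤ 1 / 2) := by
  classical
  -- bounds `Cᵢ` on the shearBump derivatives, and a common bound `C ≥ 1`
  choose C hC hCb using fun i => exists_bound_deriv_bump hη (θs i)
  set Ctot : ℝ := 1 + ∑ i, C i with hCtot
  have hCtot1 : 1 ≤ Ctot := by
    rw [hCtot]; have := Finset.sum_nonneg fun i (_ : i ∈ Finset.univ) => (hC i).le; linarith
  have hCle : ∀ i, C i ≤ Ctot := fun i => by
    rw [hCtot]
    have := Finset.single_le_sum (fun j (_ : j ∈ Finset.univ) => (hC j).le) (Finset.mem_univ i)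
    linarith
  -- the target smallness of the `φᵢ`
  set ε : ℝ := 1 / (2 * Ctot * (Fintype.card ι + 1)) with hε
  have hε0 : 0 < ε := by rw [hε]; positivity
  have hev : ∀ᶠ h in 𝓝 (0 : ℝ), ∀ i, |φ i h| < ε := by
    rw [eventually_all]
    intro i
    have hc : ContinuousAt (fun h => |φ i h|) 0 := ((hφ i).continuous.abs).continuousAt
    have h0 : |φ i 0| < ε := by rw [hφ0 i, abs_zero]; exact hε0
    exact hc.eventually (Iio_mem_nhds h0)
  obtain ⟨r, hr, hrε⟩ := Metric.eventually_nhds_iff.1 hev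
  set δ : ℝ := min (δ₀ / 2) (r / 2) with hδ
  have hδ0 : 0 < δ := by rw [hδ]; positivity
  have hδr : 2 * δ ≤ r := by
    rw [hδ]; have := min_le_right (δ₀ / 2) (r / 2); linarith
  have hφε : ∀ h, |h| < 2 * δ → ∀ i, |φ i h| < ε := fun h hh i => by
    refine hrε ?_ i
    rw [Real.dist_eq, sub_zero]; linarith
  refine ⟨δ, hδ0, by rw [hδ]; have := min_le_left (δ₀ / 2) (r / 2); linarith, fun p => ?_,
    fun p => ?_⟩
  · -- the derivative bound
    by_cases hκ : shearHeightCut δ p.2 = 0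
    · rw [hκ, zero_mul, abs_zero]; norm_num
    have hh := abs_lt_of_heightCut_ne_zero hδ0 hκ
    have hκ1 : |shearHeightCut δ p.2| ≤ 1 := by
      rw [abs_of_nonneg (heightCut_mem_Icc δ p.2).1]; exact (heightCut_mem_Icc δ p.2).2
    calc |shearHeightCut δ p.2 * ∑ i, deriv (shearBump η (θs i)) p.1 * φ i p.2|
        ≤ 1 * ∑ i, Ctot * ε := by
          rw [abs_mul]
          refine mul_le_mul hκ1 ((Finset.abs_sum_le_sum_abs _ _).trans
            (Finset.sum_le_sum fun i _ => ?_)) (abs_nonneg _) zero_le_one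
          rw [abs_mul]
          exact mul_le_mul ((hCb i p.1).trans (hCle i)) (hφε p.2 hh i).le (abs_nonneg _)
            (by linarith)
      _ = Fintype.card ι * (Ctot * ε) := by rw [one_mul, Finset.sum_const, nsmul_eq_mul]; rfl
      _ ≤ 1 / 2 := by
          rw [hε]
          have hc0 : (0 : ℝ) ≤ Fintype.card ι := by positivity
          field_simp
          nlinarith
  · -- the displacement bound
    by_cases hκ : shearHeightCut δ p.2 = 0
    · rw [shearFun, hκ, zero_mul, abs_zero]; norm_num
    have hh := abs_lt_of_heightCut_ne_zero hδ0 hκ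
    have hκ1 : |shearHeightCut δ p.2| ≤ 1 := by
      rw [abs_of_nonneg (heightCut_mem_Icc δ p.2).1]; exact (heightCut_mem_Icc δ p.2).2
    calc |shearFun δ η θs φ p|
        ≤ 1 * ∑ i, 1 * ε := by
          rw [shearFun, abs_mul]
          refine mul_le_mul hκ1 ((Finset.abs_sum_le_sum_abs _ _).trans
            (Finset.sum_le_sum fun i _ => ?_)) (abs_nonneg _) zero_le_one
          rw [abs_mul]
          refine mul_le_mul ?_ (hφε p.2 hh i).le (abs_nonneg _) zero_le_one
          rw [abs_of_nonneg (bump_mem_Icc η (θs i) p.1).1]; exact (bump_mem_Icc η (θs i) p.1).2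
      _ = Fintype.card ι * ε := by rw [one_mul, Finset.sum_const, nsmul_eq_mul, one_mul]; rfl
      _ ≤ 1 / 2 := by
          rw [hε]
          have hc0 : (0 : ℝ) ≤ Fintype.card ι := by positivity
          field_simp
          nlinarith

/-! ### §6 The shear is a diffeomorphism; the existence theorem -/

/-- A linear map `(x, y) ↦ (x + D(x, y), y)` with `1 + D(1, 0) ≠ 0` is injective. [folklore] -/
theorem injective_shearDeriv (D : ℝ × ℝ →L[ℝ] ℝ) (hD : 1 + D (1, 0) ≠ 0) :
    Injective ((ContinuousLinearMap.fst ℝ ℝ ℝ + D).prod (ContinuousLinearMap.snd ℝ ℝ ℝ)) := by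
  rw [injective_iff_map_eq_zero]
  rintro ⟨x, y⟩ h
  simp only [ContinuousLinearMap.prod_apply, add_apply,
    ContinuousLinearMap.coe_fst', ContinuousLinearMap.coe_snd', Prod.mk_eq_zero] at h
  obtain ⟨hx, hy⟩ := h
  subst hy
  have hsm : ((x, (0 : ℝ)) : ℝ × ℝ) = x • ((1 : ℝ), (0 : ℝ)) := by ext <;> simp
  rw [hsm, map_smul, smul_eq_mul, ← mul_one_add] at hx
  have hx0 : x = 0 := by
    rcases mul_eq_zero.1 hx with h | h
    · exact h
    · exact absurd h hD
  simp [hx0]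

/-- **Height-preserving periodic shears with prescribed fibres.**  Let `θᵢ` (`i` in a finite
index type) be real numbers pairwise distinct modulo `ℤ`, `φᵢ : ℝ → ℝ` smooth functions with
`φᵢ 0 = 0`, and `δ₀ > 0`.  Then there are `0 < δ < δ₀` and a diffeomorphism `Σ` of `ℝ²` of the
form `Σ (θ, h) = (θ + ψ(θ, h), h)` such that

* `Σ` preserves the height `h` and commutes with the translation `(θ, h) ↦ (θ + 1, h)` (so it
  descends to the annulus `(ℝ/ℤ) × ℝ`),
* `Σ = id` at heights `|h| ≥ δ₀`,
* `Σ (θᵢ, h) = (θᵢ + φᵢ h, h)` for `|h| ≤ δ`: **the vertical segment over `θᵢ` is carried onto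
  the graph of `φᵢ`.**

Use: in tubular coordinates `(θ, h)` around an embedded circle of a surface, a curve crossing
the circle transversally at the points of parameters `θᵢ` is, near each crossing, a graph
`θ = θᵢ + φᵢ(h)` (implicit function theorem); precomposing the tube with `Σ` gives new tubular
coordinates, with the same zero section and the same height function (hence the same parallel
circles), in which the curve is *vertical* (a union of fibres) near the circle — the normal form
used to build the smooth curve `α ∪ β₁` of a wave move by `CornerRounding.cornerArc`
(`SmoothCornerArc.lean`; Hensel (2020), §5).

Proof: `ψ(θ, h) = κ(h) Σᵢ λᵢ(θ) φᵢ(h)` with the periodic bumps `λᵢ` (`λᵢ(θᵢ) = 1`,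
`λⱼ(θᵢ) = 0`) and the height cutoff `κ`; for `δ` small `|∂ψ/∂θ| ≤ 1/2` and `|ψ| ≤ 1/2`
(`exists_delta_small`), so each slice `θ ↦ θ + ψ(θ, h)` is a strictly increasing surjection and
`DΣ` is invertible everywhere; a bijective local diffeomorphism is a diffeomorphism
(`IsLocalDiffeomorph.diffeomorphOfBijective`). [folklore] -/
theorem exists_shear (θs : ι → ℝ) (hθ : ∀ i j, i ≠ j → ∀ n : ℤ, θs i - θs j ≠ n)
    (φ : ι → ℝ → ℝ) (hφ : ∀ i, ContDiff ℝ ∞ (φ i)) (hφ0 : ∀ i, φ i 0 = 0) {δ₀ : ℝ}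
    (hδ₀ : 0 < δ₀) :
    ∃ (δ η : ℝ) (S : (ℝ × ℝ) ≃ₘ⟮𝓘(ℝ, ℝ × ℝ), 𝓘(ℝ, ℝ × ℝ)⟯ (ℝ × ℝ)), 0 < δ ∧ δ < δ₀ ∧ 0 < η ∧
      (∀ p, S p = shear δ η θs φ p) ∧
      (∀ p, (S p).2 = p.2) ∧
      (∀ p : ℝ × ℝ, S (p.1 + 1, p.2) = ((S p).1 + 1, p.2)) ∧
      (∀ p : ℝ × ℝ, δ₀ ≤ |p.2| → S p = p) ∧
      (∀ (i : ι) (h : ℝ), |h| ≤ δ → S (θs i, h) = (θs i + φ i h, h)) ∧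
      (∀ p : ℝ × ℝ, |(S p).1 - p.1| ≤ 1 / 2) := by
  classical
  -- the separation constant `η`
  obtain ⟨η, hη, hsep⟩ :
      ∃ η : ℝ, 0 < η ∧ ∀ i j, i ≠ j → 2 * η ≤ 1 - cos (2 * π * (θs i - θs j)) := by
    have hpos : ∀ i j, i ≠ j → 0 < 1 - cos (2 * π * (θs i - θs j)) := by
      intro i j hij
      have hne : cos (2 * π * (θs i - θs j)) ≠ 1 := by
        intro h1
        obtain ⟨n, hn⟩ := (cos_eq_one_iff _).1 h1
        have : θs i - θs j = n := by
          have h2π : (2 * π) ≠ 0 := by positivity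
          field_simp at hn
          linarith
        exact hθ i j hij n this
      have hle := cos_le_one (2 * π * (θs i - θs j))
      exact sub_pos.2 (lt_of_le_of_ne hle hne)
    by_cases hne : Nonempty {ij : ι × ι // ij.1 ≠ ij.2}
    · obtain ⟨⟨⟨i₀, j₀⟩, h₀⟩, hmin⟩ :=
        Finite.exists_min (fun ij : {ij : ι × ι // ij.1 ≠ ij.2} =>
          1 - cos (2 * π * (θs ij.1.1 - θs ij.1.2)))
      refine ⟨(1 - cos (2 * π * (θs i₀ - θs j₀))) / 2, by have := hpos i₀ j₀ h₀; positivity,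
        fun i j hij => ?_⟩
      have := hmin ⟨(i, j), hij⟩
      simp only at this
      linarith
    · refine ⟨1, one_pos, fun i j hij => ?_⟩
      exact absurd ⟨⟨(i, j), hij⟩⟩ hne
  -- the width `δ`
  obtain ⟨δ, hδ, hδ₀', hder, hdisp⟩ := exists_delta_small (θs := θs) hη hφ hφ0 hδ₀
  set S := shear δ η θs φ with hS
  have hSc : ContDiff ℝ ∞ S := contDiff_shear hφ
  -- `1 + ∂ψ/∂θ ≥ 1/2`
  have hpos : ∀ p : ℝ × ℝ, 1 / 2 ≤ 1 + fderiv ℝ (shearFun δ η θs φ) p (1, 0) := fun p => by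
    rw [fderiv_shearFun_apply_one_zero hφ]
    have := hder p
    rw [abs_le] at this
    linarith
  -- each slice is a strictly increasing surjection
  have hslice_der : ∀ h θ : ℝ, HasDerivAt (fun t => (S (t, h)).1)
      (1 + fderiv ℝ (shearFun δ η θs φ) (θ, h) (1, 0)) θ := fun h θ => by
    have h1 := hasDerivAt_shearFun_slice (δ := δ) (η := η) (θs := θs) (φ := φ) θ h
    rw [← fderiv_shearFun_apply_one_zero hφ (θ, h)] at h1
    have he : (fun t => (S (t, h)).1) = fun t => t + shearFun δ η θs φ (t, h) := rfl
    rw [he]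
    exact (hasDerivAt_id' θ).fun_add h1
  have hmono : ∀ h : ℝ, StrictMono fun t => (S (t, h)).1 := fun h =>
    strictMono_of_deriv_pos fun θ => by
      rw [(hslice_der h θ).deriv]
      linarith [hpos (θ, h)]
  have hsurj : ∀ h : ℝ, Surjective fun t => (S (t, h)).1 := fun h => by
    have hc : Continuous fun t => (S (t, h)).1 :=
      continuous_fst.comp (hSc.continuous.comp (continuous_id.prodMk continuous_const))
    refine hc.surjective ?_ ?_
    · refine tendsto_atTop_mono (fun t => ?_)
        (tendsto_atTop_add_const_right _ (-(1 / 2)) tendsto_id)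
      have := hdisp (t, h)
      rw [abs_le] at this
      simp only [hS, shear_fst, id]
      linarith
    · refine tendsto_atBot_mono (fun t => ?_) (tendsto_atBot_add_const_right _ (1 / 2) tendsto_id)
      have := hdisp (t, h)
      rw [abs_le] at this
      simp only [hS, shear_fst, id]
      linarith
  have hbij : Bijective S := by
    constructor
    · rintro ⟨θ₁, h₁⟩ ⟨θ₂, h₂⟩ heq
      have hh : h₁ = h₂ := by simpa [hS] using congrArg Prod.snd heq
      subst hh
      have h1 : (S (θ₁, h₁)).1 = (S (θ₂, h₁)).1 := by rw [heq]
      rw [(hmono h₁).injective h1]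
    · rintro ⟨a, h⟩
      obtain ⟨θ, hθa⟩ := hsurj h a
      exact ⟨(θ, h), Prod.ext hθa rfl⟩
  -- local diffeomorphism everywhere
  have hloc : IsLocalDiffeomorph 𝓘(ℝ, ℝ × ℝ) 𝓘(ℝ, ℝ × ℝ) ∞ S := fun p => by
    set D := fderiv ℝ (shearFun δ η θs φ) p with hD
    have hdψ : HasFDerivAt (shearFun δ η θs φ) D p :=
      (((contDiff_shearFun hφ).differentiable (by simp)) p).hasFDerivAt
    have hdS : HasFDerivAt S ((ContinuousLinearMap.fst ℝ ℝ ℝ + D).prod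
        (ContinuousLinearMap.snd ℝ ℝ ℝ)) p := by
      rw [hS]
      exact (hasFDerivAt_fst.add hdψ).prodMk (hasFDerivAt_snd (𝕜 := ℝ) (E := ℝ) (F := ℝ))
    have hinj := injective_shearDeriv D (by linarith [hpos p])
    set L : (ℝ × ℝ) ≃L[ℝ] (ℝ × ℝ) :=
      (LinearMap.linearEquivOfInjective
        (((ContinuousLinearMap.fst ℝ ℝ ℝ + D).prod (ContinuousLinearMap.snd ℝ ℝ ℝ) :
          ℝ × ℝ →L[ℝ] ℝ × ℝ) : ℝ × ℝ →ₗ[ℝ] ℝ × ℝ) hinj rfl).toContinuousLinearEquiv with hL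
    have hLcoe : (L : ℝ × ℝ →L[ℝ] ℝ × ℝ) =
        (ContinuousLinearMap.fst ℝ ℝ ℝ + D).prod (ContinuousLinearMap.snd ℝ ℝ ℝ) :=
      ContinuousLinearMap.ext fun _ => rfl
    refine isLocalDiffeomorphAt_of_mfderiv isOpen_univ (mem_univ p)
      hSc.contMDiff.contMDiffOn (by exact_mod_cast le_top) L ?_
    rw [mfderiv_eq_fderiv, hdS.fderiv, hLcoe]
  set Φ := hloc.diffeomorphOfBijective hbij with hΦ
  have hΦS : ∀ p, Φ p = S p := fun p => rfl
  refine ⟨δ, η, Φ, hδ, by linarith, hη, fun p => hΦS p, fun p => ?_, fun p => ?_, fun p hp => ?_,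
    fun i h hh => ?_, fun p => ?_⟩
  · rw [hΦS]
    rfl
  · rw [hΦS, hΦS, hS, shear_add_one]
  · rw [hΦS, hS, shear, shearFun_eq_zero_of_le_abs hδ (by linarith), add_zero]
  · rw [hΦS, hS, shear_apply_centre hδ hη hsep i hh]
  · rw [hΦS, hS, shear_fst, add_sub_cancel_left]
    exact hdisp p

end PeriodicShear

end Literature.Topology.FourManifolds

end
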